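import Summits.PneNP.PneNP.Theorems.KarlinRubinMonotoneSufficesGreedyDefs

/-!
# Crux `MonotoneSuffices` (stmt-PneNP-18026), the GREEDY general detector — part 1: counting first hits

For a candidate list `c : Fin M → V` (uniform among all `|V|^M` lists) and a target set `P` with `v₀ ∈ P`:

* `card_firstHit_mul` — `#{c : firstHit c P = some v₀} · #P = |V|^M − (|V| − #P)^M` (every element of `P` is
  equally likely to be the first hit, by the symmetry swapping two elements of `P`; and SOME element of `P` is
  hit unless all `M` candidates avoid `P`);
* `card_firstHit_ge` — hence `2 #P · #{c : firstHit c P = some v₀} ≥ |V|^M` as soon as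
  `2 (|V| − #P)^M ≤ |V|^M` (e.g. `M #P ≥ |V|`);
* `two_mul_pow_sub_le` — the latter condition from `s M ≥ N`: `2 (N-s)^M ≤ N^M`.

Pure finite combinatorics over an arbitrary finite vertex type.
-/

set_option linter.dupNamespace false -- `Summit.PneNP.PneNP.…`: summit = sub-problem name (D-0017 single-conjunct layout)

namespace Summit.PneNP.PneNP.Theorems.MonotoneSuffices.Greedy

open Finset

variable {n M : ℕ}

/-! ### Symmetry: every element of `P` is equally likely to be the first hit -/

/-- Relabelling the vertices by a permutation fixing `P` setwise transports first hits. [folklore] -/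
theorem firstHit_comp_equiv (σ : Equiv.Perm (Fin n)) (c : Fin M → Fin n) (P : Finset (Fin n))
    (hσ : ∀ v, σ v ∈ P ↔ v ∈ P) (v : Fin n) :
    firstHit (σ ∘ c) P = some (σ v) ↔ firstHit c P = some v := by
  rw [firstHit_eq_some_iff, firstHit_eq_some_iff]
  simp only [Function.comp_apply, hσ, σ.injective.eq_iff]

/-- The number of candidate lists whose first hit in `P` is `v₀` does not depend on `v₀ ∈ P`. [folklore] -/
theorem card_firstHit_eq_of_mem (P : Finset (Fin n)) {v₀ v₁ : Fin n} (h₀ : v₀ ∈ P) (h₁ : v₁ ∈ P) :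
    #((univ : Finset (Fin M → Fin n)).filter fun c => firstHit c P = some v₀) =
      #((univ : Finset (Fin M → Fin n)).filter fun c => firstHit c P = some v₁) := by
  classical
  set σ : Equiv.Perm (Fin n) := Equiv.swap v₀ v₁ with hσ
  have hσP : ∀ v, σ v ∈ P ↔ v ∈ P := by
    intro v
    rw [hσ, Equiv.swap_apply_def]
    split_ifs with h h'
    · subst h; exact ⟨fun _ => h₀, fun _ => h₁⟩
    · subst h'; exact ⟨fun _ => h₁, fun _ => h₀⟩
    · exact Iff.rfl
  -- `c ↦ σ ∘ c` is a bijection of the lists mapping `{first hit = v₀}` onto `{first hit = v₁}`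
  refine card_bij (fun c _ => σ ∘ c) (fun c hc => ?_) (fun c₁ _ c₂ _ h => ?_) (fun c' hc' => ?_)
  · rw [mem_filter] at hc ⊢
    refine ⟨mem_univ _, ?_⟩
    have := (firstHit_comp_equiv σ c P hσP v₀).2 hc.2
    rwa [hσ, Equiv.swap_apply_left, ← hσ] at this
  · funext m
    exact σ.injective (congrFun h m)
  · refine ⟨σ.symm ∘ c', ?_, ?_⟩
    · rw [mem_filter] at hc' ⊢
      refine ⟨mem_univ _, ?_⟩
      have hcomp : σ ∘ (σ.symm ∘ c') = c' := by funext m; simp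
      have hv : σ v₀ = v₁ := by rw [hσ, Equiv.swap_apply_left]
      exact (firstHit_comp_equiv σ (σ.symm ∘ c') P hσP v₀).1 (by rw [hcomp, hv]; exact hc'.2)
    · funext m; simp

/-! ### Some element is hit unless every candidate avoids `P` -/

/-- The lists with SOME first hit are those not avoiding `P` entirely. [folklore] -/
theorem card_exists_firstHit (P : Finset (Fin n)) :
    #((univ : Finset (Fin M → Fin n)).filter fun c => ∃ v, firstHit c P = some v) =
      n ^ M - (n - #P) ^ M := by
  classical
  have hsplit := card_filter_add_card_filter_not (s := (univ : Finset (Fin M → Fin n)))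
    (fun c => ∃ v, firstHit c P = some v)
  have hneg : #((univ : Finset (Fin M → Fin n)).filter fun c => ¬ ∃ v, firstHit c P = some v) = (n - #P) ^ M := by
    have heq : ((univ : Finset (Fin M → Fin n)).filter fun c => ¬ ∃ v, firstHit c P = some v) =
        Fintype.piFinset fun _ : Fin M => (univ \ P) := by
      ext c
      simp only [mem_filter, mem_univ, true_and, Fintype.mem_piFinset, mem_sdiff]
      rw [← firstHit_eq_none_iff c P]
      cases h : firstHit c P with
      | none => simp
      | some v => simp
    rw [heq, Fintype.card_piFinset, prod_const, card_univ, Fintype.card_fin, card_univ_sdiff, Fintype.card_fin]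
  rw [card_univ, Fintype.card_fun, Fintype.card_fin, Fintype.card_fin] at hsplit
  omega

/-- **First-hit count.** For `v₀ ∈ P`: `#{c : firstHit c P = some v₀} · #P = n^M − (n − #P)^M`. [folklore] -/
theorem card_firstHit_mul (P : Finset (Fin n)) {v₀ : Fin n} (h₀ : v₀ ∈ P) :
    #((univ : Finset (Fin M → Fin n)).filter fun c => firstHit c P = some v₀) * #P = n ^ M - (n - #P) ^ M := by
  classical
  rw [← card_exists_firstHit P]
  -- the lists with some first hit, partitioned by the value of the first hit (an element of `P`)
  have hunion : ((univ : Finset (Fin M → Fin n)).filter fun c => ∃ v, firstHit c P = some v) =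
      P.biUnion fun v => (univ : Finset (Fin M → Fin n)).filter fun c => firstHit c P = some v := by
    ext c
    simp only [mem_filter, mem_univ, true_and, mem_biUnion]
    constructor
    · rintro ⟨v, hv⟩; exact ⟨v, firstHit_mem hv, hv⟩
    · rintro ⟨v, -, hv⟩; exact ⟨v, hv⟩
  rw [hunion, card_biUnion]
  · rw [sum_congr rfl fun v hv => card_firstHit_eq_of_mem P hv h₀, sum_const, smul_eq_mul, mul_comm]
  · intro v _ w _ hvw
    simp only [Function.onFun, disjoint_filter, mem_univ, true_imp_iff]
    intro c hv hw
    rw [hv] at hw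
    exact hvw (Option.some_injective _ hw)

/-- `2 (N - s)^M ≤ N^M` once `N ≤ s M` (from `(1 - s/N)^M ≤ e^{-sM/N} ≤ e^{-1} < 1/2`). [folklore] -/
theorem two_mul_pow_sub_le {N s M : ℕ} (hs : s ≤ N) (hM : N ≤ s * M) (hN : 0 < N) : 2 * (N - s) ^ M ≤ N ^ M := by
  have hreal : 2 * ((N : ℝ) - s) ^ M ≤ (N : ℝ) ^ M := by
    have hN' : (0 : ℝ) < N := by exact_mod_cast hN
    have hx0 : (0 : ℝ) ≤ 1 - (s : ℝ) / N := by
      rw [sub_nonneg, div_le_one hN']; exact_mod_cast hs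
    have h1 : (1 - (s : ℝ) / N) ^ M ≤ Real.exp (-((s : ℝ) / N * M)) := by
      have h := Real.add_one_le_exp (-((s : ℝ) / N))
      calc (1 - (s : ℝ) / N) ^ M ≤ (Real.exp (-((s : ℝ) / N))) ^ M :=
            pow_le_pow_left₀ hx0 (by linarith) M
        _ = Real.exp (-((s : ℝ) / N * M)) := by rw [← Real.exp_nat_mul]; ring_nf
    have h2 : Real.exp (-((s : ℝ) / N * M)) ≤ Real.exp (-1) := by
      refine Real.exp_le_exp.2 (neg_le_neg ?_)
      rw [div_mul_eq_mul_div, le_div_iff₀ hN', one_mul]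
      exact_mod_cast hM
    have h3 : Real.exp (-1) < 1 / 2 := by
      have := Real.exp_one_gt_d9
      rw [Real.exp_neg, inv_lt_comm₀ (Real.exp_pos _) (by norm_num)]
      linarith
    have hkey : 2 * (1 - (s : ℝ) / N) ^ M ≤ 1 := by linarith [h1.trans h2]
    have hfac : ((N : ℝ) - s) ^ M = (N : ℝ) ^ M * (1 - (s : ℝ) / N) ^ M := by
      rw [← mul_pow]; congr 1; field_simp
    rw [hfac]
    nlinarith [pow_pos hN' M]
  have hcast : ((2 * (N - s) ^ M : ℕ) : ℝ) ≤ ((N ^ M : ℕ) : ℝ) := by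
    push_cast [Nat.cast_sub hs]
    exact hreal
  exact_mod_cast hcast

/-- **First-hit count, lower bound.** If `v₀ ∈ P` and `n ≤ #P · M`, then at least a `1/(2 #P)` fraction of
all candidate lists have first hit `v₀`: `n^M ≤ 2 #P · #{c : firstHit c P = some v₀}`. [folklore] -/
theorem card_firstHit_ge (P : Finset (Fin n)) {v₀ : Fin n} (h₀ : v₀ ∈ P) (hM : n ≤ #P * M) :
    n ^ M ≤ 2 * #P * #((univ : Finset (Fin M → Fin n)).filter fun c => firstHit c P = some v₀) := by
  have hPn : #P ≤ n := by simpa using card_le_univ P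
  have hn : 0 < n := Fin.pos v₀
  have h := card_firstHit_mul (M := M) P h₀
  have h2 := two_mul_pow_sub_le hPn hM hn
  have hle : (n - #P) ^ M ≤ n ^ M := Nat.pow_le_pow_left (Nat.sub_le _ _) M
  calc n ^ M ≤ 2 * (n ^ M - (n - #P) ^ M) := by omega
    _ = 2 * (#((univ : Finset (Fin M → Fin n)).filter fun c => firstHit c P = some v₀) * #P) := by rw [h]
    _ = 2 * #P * #((univ : Finset (Fin M → Fin n)).filter fun c => firstHit c P = some v₀) := by ring

end Summit.PneNP.PneNP.Theorems.MonotoneSuffices.Greedy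

namespace Summit.PneNP.PneNP.Theorems.MonotoneSuffices.Greedy

open Finset

/-- Registered sub-goal `greedy_count` of stmt-PneNP-18026 (greedy detector, part 1): the first-hit count,
exported verbatim. [folklore] -/
theorem greedy_count :
    ∀ {n M : ℕ} (P : Finset (Fin n)) {v₀ : Fin n}, v₀ ∈ P → n ≤ #P * M → n ^ M ≤ 2 * #P * #((Finset.univ : Finset (Fin M → Fin n)).filter fun c => Summit.PneNP.PneNP.Theorems.MonotoneSuffices.Greedy.firstHit c P = some v₀) :=
  fun P _ h₀ hM => card_firstHit_ge P h₀ hM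

end Summit.PneNP.PneNP.Theorems.MonotoneSuffices.Greedy
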